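import Literature.AnabelianGeometry.AbsoluteAnabelian.AutHolomorphicSpacesDiscPictureProofs
import Literature.AnabelianGeometry.AbsoluteAnabelian.AutHolomorphicSpacesCayleyProofs
import Mathlib.Analysis.Complex.UpperHalfPlane.ProperAction
import HarnessLib

/-!
# `Aut^hol` of an Aut-holomorphic disc versus `SL(2, ℝ)`: algebra (PROOF-ONLY, [AbsTopIII] Prop. 2.2 (ii))

For a Riemann surface `Y` with a biholomorphic homeomorphism `κ : Y ≃ₜ ℍ` onto Mathlib's upper
half plane, the elements `g ∈ SL(2, ℝ)` act on `Y` by the biholomorphic self-homeomorphisms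
`κ⁻¹ ∘ (g • ·) ∘ κ` (`conjugated Möbius transformations`).  We prove: they are biholomorphic
(`mdifferentiable_conjSmul`), the assignment is multiplicative, its kernel is the centre `{±1}`
(`conjSmul_eq_refl_iff`), two elements with the same action on `κ⁻¹ i`, `κ⁻¹ 2i` differ by the
centre (`smul_I_smul_twoI_inj`), and — the substance, via the tree's `Aut(𝔻)` classification and
the Cayley transform — EVERY biholomorphic self-homeomorphism of `Y` is of this form
(`exists_conjSmul_eq`).  The topological-group isomorphism `Aut^hol(Y) ≅ SL(2, ℝ)/{±1}` is
assembled in `AutHolomorphicSpacesPSL2RProofs`.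

[cite: MochizukiAbsTopIII2015, Proposition 2.2 (ii) p.52]
-/

noncomputable section

namespace Literature.AnabelianGeometry.AbsoluteAnabelian

open _root_.TopologicalSpace _root_.Topology _root_.Set _root_.Metric _root_.Function _root_.Filter
open scoped _root_.Manifold _root_.ContDiff ComplexConjugate UpperHalfPlane MatrixGroups
open _root_.UpperHalfPlane Literature.Analysis.Complex

/-! ### Möbius transformations of `ℍ` given by `SL(2, ℝ)` -/

/-- The coordinate formula for `g • τ`, `g ∈ SL(2, ℝ)`. [cite: MochizukiAbsTopIII2015, Proposition 2.2 (ii) p.52] -/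
theorem coe_sl_smul (g : SL(2, ℝ)) (τ : ℍ) :
    ((g • τ : ℍ) : ℂ) = ((g 0 0 : ℝ) * (τ : ℂ) + (g 0 1 : ℝ)) / ((g 1 0 : ℝ) * (τ : ℂ) + (g 1 1 : ℝ)) := by
  rw [UpperHalfPlane.coe_specialLinearGroup_apply]
  simp only [Algebra.algebraMap_self, RingHom.id_apply]

/-- The denominator `c τ + d` of `g ∈ SL(2, ℝ)` does not vanish on the upper half plane.
[cite: MochizukiAbsTopIII2015, Proposition 2.2 (ii) p.52] -/
theorem sl_denom_ne_zero (g : SL(2, ℝ)) {z : ℂ} (hz : 0 < z.im) :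
    ((g 1 0 : ℝ) : ℂ) * z + (g 1 1 : ℝ) ≠ 0 := by
  intro h
  have him := congrArg Complex.im h
  simp only [Complex.add_im, Complex.mul_im, Complex.ofReal_re, Complex.ofReal_im, zero_mul,
    add_zero, Complex.zero_im] at him
  have hre := congrArg Complex.re h
  simp only [Complex.add_re, Complex.mul_re, Complex.ofReal_re, Complex.ofReal_im, zero_mul,
    sub_zero, Complex.zero_re] at hre
  have hc : g 1 0 = 0 := by
    rcases mul_eq_zero.1 him with h1 | h1
    · exact h1
    · exact absurd h1 hz.ne'
  have h11 : g 1 1 = 0 := by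
    rw [hc] at hre
    simpa using hre
  have hdet := g.2
  rw [Matrix.det_fin_two, hc, h11] at hdet
  simp at hdet

/-- **Möbius transformations are holomorphic** on `ℍ` (in the typed `MDifferentiable` sense).
[cite: MochizukiAbsTopIII2015, Proposition 2.2 (ii) p.52] -/
theorem mdifferentiable_sl_smul (g : SL(2, ℝ)) :
    MDifferentiable 𝓘(ℂ, ℂ) 𝓘(ℂ, ℂ) (fun τ : ℍ => g • τ) := by
  intro τ
  rw [mdifferentiableAt_upperHalfPlane_iff, ← mdifferentiableAt_comp_ofComplex_iff,
    mdifferentiableAt_iff_differentiableAt]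
  have hev : (fun z : ℂ => (((g 0 0 : ℝ) : ℂ) * z + (g 0 1 : ℝ)) / (((g 1 0 : ℝ) : ℂ) * z + (g 1 1 : ℝ)))
      =ᶠ[𝓝 (τ : ℂ)] ((fun y : ℍ => ((g • y : ℍ) : ℂ)) ∘ UpperHalfPlane.ofComplex) := by
    filter_upwards [UpperHalfPlane.isOpen_upperHalfPlaneSet.mem_nhds τ.im_pos] with z hz
    rw [comp_apply, coe_sl_smul, UpperHalfPlane.ofComplex_apply_of_im_pos hz]
  refine DifferentiableAt.congr_of_eventuallyEq ?_ hev.symm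
  have hd := sl_denom_ne_zero g τ.im_pos
  exact DifferentiableAt.div (c := fun z : ℂ => ((g 0 0 : ℝ) : ℂ) * z + (g 0 1 : ℝ))
    (d := fun z : ℂ => ((g 1 0 : ℝ) : ℂ) * z + (g 1 1 : ℝ)) (by fun_prop) (by fun_prop) hd

/-! ### Conjugated Möbius transformations of `Y` -/

section Conj

variable {Y : Type} [TopologicalSpace Y]

/-- The conjugated Möbius transformation at a point. [cite: MochizukiAbsTopIII2015, Proposition 2.2 (ii) p.52] -/
theorem conjSmul_apply (κ : Y ≃ₜ ℍ) (g : SL(2, ℝ)) (y : Y) :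
    (κ.trans ((Homeomorph.smul g).trans κ.symm)) y = κ.symm (g • κ y) := rfl

/-- Multiplicativity. [cite: MochizukiAbsTopIII2015, Proposition 2.2 (ii) p.52] -/
theorem conjSmul_mul (κ : Y ≃ₜ ℍ) (g h : SL(2, ℝ)) :
    κ.trans ((Homeomorph.smul (g * h)).trans κ.symm) =
      κ.trans ((Homeomorph.smul g).trans κ.symm) * κ.trans ((Homeomorph.smul h).trans κ.symm) := by
  ext y
  simp only [Homeomorph.mul_apply, conjSmul_apply, Homeomorph.apply_symm_apply, mul_smul]

/-- Unit. [cite: MochizukiAbsTopIII2015, Proposition 2.2 (ii) p.52] -/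
theorem conjSmul_one (κ : Y ≃ₜ ℍ) :
    κ.trans ((Homeomorph.smul (1 : SL(2, ℝ))).trans κ.symm) = 1 := by
  ext y
  simp only [conjSmul_apply, one_smul, Homeomorph.symm_apply_apply]
  rfl

/-- The point `2i ∈ ℍ`. (Existence form.) [cite: MochizukiAbsTopIII2015, Proposition 2.2 (ii) p.52] -/
theorem twoI_im_pos : 0 < (2 * Complex.I).im := by simp

/-- **Rigidity on two points**: two elements of `SL(2, ℝ)` with the same action on `i` and on `2i`
differ by `±1`. [cite: MochizukiAbsTopIII2015, Proposition 2.2 (ii) p.52] -/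
theorem eq_or_eq_neg_of_smul_eq {g : SL(2, ℝ)} (h1 : g • UpperHalfPlane.I = UpperHalfPlane.I)
    (h2 : g • (⟨2 * Complex.I, twoI_im_pos⟩ : ℍ) = ⟨2 * Complex.I, twoI_im_pos⟩) :
    g = 1 ∨ g = -1 := by
  have e1 := congrArg (fun z : ℍ => (z : ℂ)) h1
  have e2 := congrArg (fun z : ℍ => (z : ℂ)) h2
  simp only [coe_sl_smul, UpperHalfPlane.coe_I] at e1 e2
  have hd1 := sl_denom_ne_zero g (show 0 < Complex.I.im by simp)
  have hd2 := sl_denom_ne_zero g twoI_im_pos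
  rw [div_eq_iff hd1] at e1
  rw [div_eq_iff hd2] at e2
  -- compare real and imaginary parts
  have r1 := congrArg Complex.re e1
  have i1 := congrArg Complex.im e1
  have r2 := congrArg Complex.re e2
  have i2 := congrArg Complex.im e2
  simp only [Complex.add_re, Complex.mul_re, Complex.ofReal_re, Complex.ofReal_im, Complex.I_re,
    Complex.I_im, Complex.add_im, Complex.mul_im, Complex.re_ofNat, Complex.im_ofNat] at r1 i1 r2 i2
  ring_nf at r1 i1 r2 i2
  have hdet := g.2
  rw [Matrix.det_fin_two] at hdet
  -- solve: g 1 0 = 0, g 0 1 = 0, g 0 0 = g 1 1, product 1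
  have hc : g 1 0 = 0 := by nlinarith
  have hb : g 0 1 = 0 := by nlinarith
  have had : g 0 0 = g 1 1 := by nlinarith
  rw [hc, hb, had] at hdet
  have hsq : g 1 1 = 1 ∨ g 1 1 = -1 := by
    have : (g 1 1 - 1) * (g 1 1 + 1) = 0 := by nlinarith
    rcases mul_eq_zero.1 this with h | h
    · exact Or.inl (by linarith)
    · exact Or.inr (by linarith)
  rcases hsq with h | h
  · left
    ext i j
    fin_cases i <;> fin_cases j <;> simp [hc, hb, had, h]
  · right
    ext i j
    fin_cases i <;> fin_cases j <;> simp [hc, hb, had, h]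

/-- `±1` act trivially on `ℍ`. [cite: MochizukiAbsTopIII2015, Proposition 2.2 (ii) p.52] -/
theorem neg_one_sl_smul (τ : ℍ) : (-1 : SL(2, ℝ)) • τ = τ := by
  apply UpperHalfPlane.ext
  rw [coe_sl_smul]
  simp [Matrix.SpecialLinearGroup.coe_neg]

/-- The centre of `SL(2, ℝ)` is `{±1}`. [cite: MochizukiAbsTopIII2015, Proposition 2.2 (ii) p.52] -/
theorem mem_center_sl_iff {g : SL(2, ℝ)} : g ∈ Subgroup.center SL(2, ℝ) ↔ g = 1 ∨ g = -1 := by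
  rw [Matrix.SpecialLinearGroup.mem_center_iff]
  constructor
  · rintro ⟨r, hr, hrg⟩
    simp only [Fintype.card_fin] at hr
    have : r = 1 ∨ r = -1 := by
      have : (r - 1) * (r + 1) = 0 := by nlinarith
      rcases mul_eq_zero.1 this with h | h
      · exact Or.inl (by linarith)
      · exact Or.inr (by linarith)
    rcases this with rfl | rfl
    · left
      apply Subtype.ext
      rw [← hrg]; simp
    · right
      apply Subtype.ext
      rw [← hrg, map_neg, map_one]; simp [Matrix.SpecialLinearGroup.coe_neg]
  · rintro (rfl | rfl)
    · exact ⟨1, by simp, by simp⟩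
    · exact ⟨-1, by simp, by rw [map_neg, map_one]; simp [Matrix.SpecialLinearGroup.coe_neg]⟩

/-- **Kernel**: the conjugated Möbius transformation of `g` is the identity iff `g = ±1`, i.e. iff
`g` lies in the centre. [cite: MochizukiAbsTopIII2015, Proposition 2.2 (ii) p.52] -/
theorem conjSmul_eq_one_iff (κ : Y ≃ₜ ℍ) {g : SL(2, ℝ)} :
    κ.trans ((Homeomorph.smul g).trans κ.symm) = 1 ↔ g ∈ Subgroup.center SL(2, ℝ) := by
  rw [mem_center_sl_iff]
  constructor
  · intro h
    have hfix : ∀ τ : ℍ, g • τ = τ := by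
      intro τ
      have := congrArg (fun ψ : Y ≃ₜ Y => κ (ψ (κ.symm τ))) h
      simpa [conjSmul_apply] using this
    exact eq_or_eq_neg_of_smul_eq (hfix _) (hfix _)
  · rintro (rfl | rfl)
    · exact conjSmul_one κ
    · ext y
      simp only [conjSmul_apply, neg_one_sl_smul, Homeomorph.symm_apply_apply]
      rfl

/-- Two elements with the same conjugated action on `κ⁻¹ i` and `κ⁻¹ 2i` are equal up to the
centre. [cite: MochizukiAbsTopIII2015, Proposition 2.2 (ii) p.52] -/
theorem smul_I_smul_twoI_inj {g g' : SL(2, ℝ)} (h1 : g • UpperHalfPlane.I = g' • UpperHalfPlane.I)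
    (h2 : g • (⟨2 * Complex.I, twoI_im_pos⟩ : ℍ) = g' • ⟨2 * Complex.I, twoI_im_pos⟩) :
    g⁻¹ * g' ∈ Subgroup.center SL(2, ℝ) := by
  rw [mem_center_sl_iff]
  refine eq_or_eq_neg_of_smul_eq ?_ ?_
  · rw [mul_smul, ← h1, ← mul_smul, inv_mul_cancel, one_smul]
  · rw [mul_smul, ← h2, ← mul_smul, inv_mul_cancel, one_smul]

variable [ChartedSpace ℂ Y]

/-- **Conjugated Möbius transformations are biholomorphic.** [cite: MochizukiAbsTopIII2015, Proposition 2.2 (ii) p.52] -/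
theorem mdifferentiable_conjSmul (κ : Y ≃ₜ ℍ) (hκ : MDifferentiable 𝓘(ℂ, ℂ) 𝓘(ℂ, ℂ) κ)
    (hκs : MDifferentiable 𝓘(ℂ, ℂ) 𝓘(ℂ, ℂ) κ.symm) (g : SL(2, ℝ)) :
    MDifferentiable 𝓘(ℂ, ℂ) 𝓘(ℂ, ℂ) (κ.trans ((Homeomorph.smul g).trans κ.symm)) ∧
      MDifferentiable 𝓘(ℂ, ℂ) 𝓘(ℂ, ℂ) (κ.trans ((Homeomorph.smul g).trans κ.symm)).symm := by
  constructor
  · have : (⇑(κ.trans ((Homeomorph.smul g).trans κ.symm))) = ⇑κ.symm ∘ (fun τ : ℍ => g • τ) ∘ ⇑κ :=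
      rfl
    rw [this]
    exact hκs.comp ((mdifferentiable_sl_smul g).comp hκ)
  · have : (⇑(κ.trans ((Homeomorph.smul g).trans κ.symm)).symm) =
        ⇑κ.symm ∘ (fun τ : ℍ => g⁻¹ • τ) ∘ ⇑κ := by
      funext y
      simp only [comp_apply]
      rfl
    rw [this]
    exact hκs.comp ((mdifferentiable_sl_smul g⁻¹).comp hκ)

/-- **Surjectivity onto `Aut^hol(Y)`**: every biholomorphic self-homeomorphism of `Y` is a
conjugated Möbius transformation.  Via transitivity (`toSL2R`), the Cayley transform and the
tree's "automorphisms of the disc fixing `0` are rotations", realised by the rotation matrices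
`k_t`. [cite: MochizukiAbsTopIII2015, Proposition 2.2 (ii) p.52] -/
theorem exists_conjSmul_eq (κ : Y ≃ₜ ℍ) (hκ : MDifferentiable 𝓘(ℂ, ℂ) 𝓘(ℂ, ℂ) κ)
    (hκs : MDifferentiable 𝓘(ℂ, ℂ) 𝓘(ℂ, ℂ) κ.symm) {ψ : Y ≃ₜ Y}
    (hψ : MDifferentiable 𝓘(ℂ, ℂ) 𝓘(ℂ, ℂ) ψ) (hψs : MDifferentiable 𝓘(ℂ, ℂ) 𝓘(ℂ, ℂ) ψ.symm) :
    ∃ g : SL(2, ℝ), κ.trans ((Homeomorph.smul g).trans κ.symm) = ψ := by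
  obtain ⟨C, hC, hCs, hCw, hCz⟩ := exists_cayley
  have h0 : (0 : ℂ) ∈ unitDiscOpens := by
    show (0 : ℂ) ∈ Metric.ball (0 : ℂ) 1; exact mem_ball_self one_pos
  have hC0 : C.symm UpperHalfPlane.I = ⟨0, h0⟩ := by
    apply Subtype.ext; rw [hCz]; simp [UpperHalfPlane.coe_I]
  -- the disc coordinate of `Y`
  set e : Y ≃ₜ unitDiscOpens := κ.trans C.symm with he_def
  have he : MDifferentiable 𝓘(ℂ, ℂ) 𝓘(ℂ, ℂ) e := hCs.comp hκ
  have hes : MDifferentiable 𝓘(ℂ, ℂ) 𝓘(ℂ, ℂ) e.symm := hκs.comp hC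
  -- move `ψ (κ⁻¹ i)` back to `κ⁻¹ i`
  set g₀ : SL(2, ℝ) := UpperHalfPlane.toSL2R (κ (ψ (κ.symm UpperHalfPlane.I))) with hg₀
  set ρ₀ := κ.trans ((Homeomorph.smul g₀).trans κ.symm) with hρ₀
  set ψ₁ : Y ≃ₜ Y := ρ₀⁻¹ * ψ with hψ₁
  have hρ₀d := mdifferentiable_conjSmul κ hκ hκs g₀
  have hψ₁d : MDifferentiable 𝓘(ℂ, ℂ) 𝓘(ℂ, ℂ) ψ₁ := hρ₀d.2.comp hψ
  have hψ₁s : MDifferentiable 𝓘(ℂ, ℂ) 𝓘(ℂ, ℂ) ψ₁.symm := hψs.comp hρ₀d.1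
  have hfix : ψ₁ (κ.symm UpperHalfPlane.I) = κ.symm UpperHalfPlane.I := by
    simp only [hψ₁, Homeomorph.mul_apply]
    show ρ₀.symm (ψ (κ.symm UpperHalfPlane.I)) = κ.symm UpperHalfPlane.I
    rw [Homeomorph.symm_apply_eq]
    simp [hρ₀, hg₀, UpperHalfPlane.toSL2R_smul_I]
  -- its disc picture is a rotation
  have haut := isDiscAut_pic e he hes hψ₁d hψ₁s
  have hpic0 : Function.extend Subtype.val (Subtype.val ∘ (e.symm.trans (ψ₁.trans e)))
      (fun _ => (0 : ℂ)) 0 = 0 := by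
    rw [pic_apply_of_mem e ψ₁ (mem_ball_self one_pos)]
    have h1 : e.symm ⟨0, mem_ball_self one_pos⟩ = κ.symm UpperHalfPlane.I := by
      have hC0' : C ⟨0, h0⟩ = UpperHalfPlane.I := by rw [← hC0, C.apply_symm_apply]
      simp only [he_def, Homeomorph.symm_trans_apply, Homeomorph.symm_symm]
      exact congrArg κ.symm hC0'
    rw [h1, hfix]
    simp only [he_def, Homeomorph.trans_apply, Homeomorph.apply_symm_apply, hC0]
  obtain ⟨c, hc, hrot⟩ := haut.exists_eq_mul_of_map_zero hpic0
  obtain ⟨t, ht⟩ := exists_cos_sub_sin_sq_eq hc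
  obtain ⟨k, hk00, hk01, hk10, hk11⟩ := exists_rotation_SL2 t
  -- `ψ₁` is the conjugated rotation `k`
  have hψ₁k : κ.trans ((Homeomorph.smul k).trans κ.symm) = ψ₁ := by
    refine eq_of_pic_eqOn e fun z hz => ?_
    rw [hrot hz, pic_apply_of_mem e _ hz]
    simp only [he_def, Homeomorph.trans_apply, Homeomorph.symm_trans_apply, Homeomorph.symm_symm,
      Homeomorph.apply_symm_apply, Homeomorph.smul_apply]
    rw [hCz, cayley_rotation_smul hk00 hk01 hk10 hk11, ht, ← hCz, C.symm_apply_apply]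
  have hψeq : ψ = ρ₀ * ψ₁ := by rw [hψ₁, mul_inv_cancel_left]
  exact ⟨g₀ * k, by rw [conjSmul_mul, hψ₁k, ← hρ₀, ← hψeq]⟩

end Conj

end Literature.AnabelianGeometry.AbsoluteAnabelian
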